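import Mathlib
import Summits.Schanuel.Schanuel.Theorems.RigidCoreMinimalCounterexampleInAclCosetLineSparsityOfFree
import Literature.FieldTheory.TranscendenceDegree.AlgebraicDependenceBookkeeping
import Literature.RingTheory.NoetherNormalization.GenericLinearForms

/-!
# R1♮: generic free coset-line sparsity implies the generic dimension-drop form — crux stmt-Schanuel-0969

Line `kernel-arithmetic-selection`, registered stub `stub_genericSparsity_of_free` (R1♮,
`--supports stmt-Schanuel-0969`): FCS♮⁺ ∧ CURVE ⟹ FCS♮, the `K`-generic analogue of R1
(`stub_cosetLineSparsity_of_free`, file `…CosetLineSparsityOfFree`).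

**Setting.**  A *coset family* is `q : ℤ → ℂ^ι` with `q_j` ℚ-linearly independent and
`q_j i₀ = c + 2πi j` along `J ⊆ ℤ`, fibre-finite (`{j ∈ J : e^{q_j} = ω}` finite for every `ω`);
its points are `P_j := (q_j, e^{q_j}) ∈ ℂ^ι × ℂ^ι`.  Constants `ev : κ → ℂ` generate the field
`K := ℚ(ev)`; "same type along `J`" means that the polynomial relations over ℚ between `ev` and
`P_j` do not depend on `j ∈ J`.  Densities are in window-count form (see the R1 file): positive
upper Banach density `∃ δ > 0, ∀ N₀, ∃ N ≥ N₀, ∃ a, δ N ≤ #(S ∩ [a, a + N))`, density zero its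
negation.

* FCS♮⁺ (first antecedent): same type over `K`, a coordinate set `T` with `#T ≥ 2` on which `P_{j₀}`
  is `K`-algebraically independent and over which (with `K`) every coordinate of `P_{j₀}` is
  algebraic, a lattice `Λ` dead along `J` with `#T + rank Λ < #ι`, and hereditary freeness modulo
  `Λ` on positive-density sub-families ⟹ density zero.
* CURVE (second antecedent): same type over `K` and every coordinate algebraic over
  `K[≤ 1 coordinate]` ⟹ density zero.
* FCS♮ (conclusion): if along EVERY positive-density `J' ⊆ J` and for EVERY lattice `Λ` dead along
  `J'` there are constants `ev` (same type along `J'`) and a coordinate set `T` with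
  `#T + rank Λ < #ι` over which every coordinate is algebraic, then density zero.

**Proof.**  As in R1: suppose some `J₁ ⊆ J` has positive upper Banach density and pick a
positive-density `J* ⊆ J` whose dead lattice `Λ(J*)` (`exists_deadLattice`) has maximal rank
(`Nat.findGreatest`).  FCS♮ supplies `ev, j₀, T₀` at `(J*, Λ(J*))`.  Shrink: a finset `T` of
coordinates of maximal cardinality on which `P_{j₀}` is `K`-algebraically independent has every
coordinate algebraic over `K[P_{j₀}(T)]` (`AlgebraicIndepOn.insert`, maximality), and
`#T ≤ trdeg_K K[P_{j₀}] ≤ #P_{j₀}(T₀) ≤ #T₀` (`AlgebraicIndependent.cardinalMk_le_trdeg`,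
`trdeg_adjoin_le_of_forall_isAlgebraic`), so `#T + rank Λ(J*) < #ι`.  If `#T ≤ 1`, CURVE makes `J*`
density zero; if `#T ≥ 2`, FCS♮⁺ does, its hereditary freeness being supplied by the maximality of
the rank exactly as in R1 (`exists_fibre_of_posDensity`, `finrank_add_one_le_of_free`).  Either way
this contradicts the positive density of `J*`.
-/

noncomputable section

set_option linter.dupNamespace false

namespace Summit.Schanuel.Schanuel.Cruxes.MinimalCounterexampleInAcl.KernelArithmeticSelection

open Literature.FieldTheory.TranscendenceDegree Literature.RingTheory.NoetherNormalization

/-! ## Maximal algebraically independent coordinate sets -/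

/-- **Shrinking to an independent coordinate set.**  For a point `P : σ → K` (finitely many
coordinates) over a subfield `F`, there is a finset `T` of coordinates on which `P` is
`F`-algebraically independent and over which every coordinate of `P` is algebraic: take `T` of
maximal cardinality among the independent ones (`AlgebraicIndepOn.insert`). [folklore] -/
theorem exists_finset_algebraicIndepOn_isAlgebraic {F K : Type*} [Field F] [Field K] [Algebra F K]
    {σ : Type*} [Fintype σ] (P : σ → K) :
    ∃ T : Finset σ, AlgebraicIndepOn F P (↑T : Set σ) ∧
      ∀ v : σ, IsAlgebraic (Algebra.adjoin F (P '' (↑T : Set σ))) (P v) := by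
  classical
  let good : Finset σ → Prop := fun T => AlgebraicIndepOn F P (↑T : Set σ)
  have hgood0 : good ∅ := by
    have : IsEmpty (↥((∅ : Finset σ) : Set σ)) := ⟨fun x => Finset.notMem_empty x.1 x.2⟩
    exact algebraicIndependent_empty_type_iff.mpr (algebraMap F K).injective
  have hne : ((Finset.univ : Finset (Finset σ)).filter good).Nonempty :=
    ⟨∅, Finset.mem_filter.2 ⟨Finset.mem_univ _, hgood0⟩⟩
  obtain ⟨T, hT, hmax⟩ := Finset.exists_max_image _ Finset.card hne
  simp only [Finset.mem_filter, Finset.mem_univ, true_and] at hT hmax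
  refine ⟨T, hT, fun v => ?_⟩
  by_contra htr
  have hvT : v ∉ T := fun hv =>
    htr (isAlgebraic_adjoin_of_mem (Set.mem_image_of_mem P (Finset.mem_coe.2 hv)))
  have hins : AlgebraicIndepOn F P (insert v (↑T : Set σ)) := hT.insert htr
  have hgood : good (insert v T) := by
    show AlgebraicIndepOn F P (↑(insert v T) : Set σ)
    rwa [Finset.coe_insert]
  have := hmax _ hgood
  rw [Finset.card_insert_of_notMem hvT] at this
  omega

/-- **Counting an independent coordinate set.**  If `P` is `F`-algebraically independent on the
finset `T` of coordinates and every coordinate of `P` is algebraic over `F[P(T₀)]`, then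
`#T ≤ #T₀`: `#T ≤ trdeg_F F[P] ≤ #P(T₀) ≤ #T₀`. [folklore] -/
theorem card_le_card_of_algebraicIndepOn_of_isAlgebraic {F : Type*} {K : Type} [Field F] [Field K]
    [Algebra F K] {σ : Type} (P : σ → K) {T T₀ : Finset σ}
    (hT : AlgebraicIndepOn F P (↑T : Set σ))
    (halg : ∀ v : σ, IsAlgebraic (Algebra.adjoin F (P '' (↑T₀ : Set σ))) (P v)) :
    T.card ≤ T₀.card := by
  set B : Subalgebra F K := Algebra.adjoin F (Set.range P) with hB
  have hmemB : ∀ t : ↥(↑T : Set σ), P t ∈ B := fun t => Algebra.subset_adjoin ⟨t, rfl⟩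
  let w : ↥(↑T : Set σ) → B := fun t => ⟨P t, hmemB t⟩
  have hw : AlgebraicIndependent F w := AlgebraicIndependent.of_comp B.val hT
  have h1 := hw.cardinalMk_le_trdeg
  have h2 : Algebra.trdeg F B ≤ Cardinal.mk (P '' (↑T₀ : Set σ)) :=
    trdeg_adjoin_le_of_forall_isAlgebraic (K := F) (s := Set.range P) (t := P '' (↑T₀ : Set σ))
      (by rintro _ ⟨v, rfl⟩; exact halg v)
  have h3 : Cardinal.mk (P '' (↑T₀ : Set σ)) ≤ Cardinal.mk (↥(↑T₀ : Set σ)) := Cardinal.mk_image_le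
  have h := (h1.trans h2).trans h3
  simp only [Finset.coe_sort_coe, Cardinal.mk_coe_finset, Nat.cast_le] at h
  exact h

/-! ## The reduction -/

/-- **Core of R1♮ (curried form).** Under FCS♮⁺ and CURVE (both specialised to the ambient data
`ι, i₀, c, q`) and the FCS♮ hypotheses for the family `q` along `J`, no sub-family `J₁ ⊆ J` has
positive upper Banach density: maximal-rank dead lattice, shrinking of the coordinate set to a
maximal `K`-algebraically independent one, and dispatch on its size. [folklore] -/
theorem false_of_posDensity_of_generic {ι : Type} [Fintype ι] (i₀ : ι) (c : ℂ) (J : Set ℤ)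
    (q : ℤ → ι → ℂ)
    (hPlus : ∀ (J₀ : Set ℤ) (Λ : Submodule ℤ (ι → ℤ)) (κ : Type) (ev : κ → ℂ) (j₀ : ℤ)
      (T : Finset (ι ⊕ ι)), j₀ ∈ J₀ → 2 ≤ T.card → T.card + Module.finrank ℤ ↥Λ < Fintype.card ι →
      (∀ j ∈ J₀, LinearIndependent ℚ (q j) ∧ q j i₀ = c + 2 * ↑Real.pi * Complex.I * (j : ℂ)) →
      (∀ ω : ι → ℂ, Set.Finite {j : ℤ | j ∈ J₀ ∧ Complex.exp ∘ q j = ω}) →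
      (∀ M ∈ Λ, ∀ j ∈ J₀, ∀ j' ∈ J₀, (∑ i, (M i : ℂ) * q j i) = ∑ i, (M i : ℂ) * q j' i) →
      (∀ j ∈ J₀, ∀ H : MvPolynomial (κ ⊕ (ι ⊕ ι)) ℚ,
        MvPolynomial.aeval (Sum.elim ev (Sum.elim (q j₀) (Complex.exp ∘ q j₀))) H = 0 ↔
        MvPolynomial.aeval (Sum.elim ev (Sum.elim (q j) (Complex.exp ∘ q j))) H = 0) →
      AlgebraicIndependent ↥(IntermediateField.adjoin ℚ (Set.range ev))
        (fun t : ↥T => Sum.elim (q j₀) (Complex.exp ∘ q j₀) (↑t : ι ⊕ ι)) →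
      (∀ v : ι ⊕ ι, IsAlgebraic ↥(Algebra.adjoin ↥(IntermediateField.adjoin ℚ (Set.range ev))
        ((Sum.elim (q j₀) (Complex.exp ∘ q j₀)) '' (↑T : Set (ι ⊕ ι))))
        (Sum.elim (q j₀) (Complex.exp ∘ q j₀) v)) →
      (∀ J' ⊆ J₀, (∃ δ : ℝ, 0 < δ ∧ ∀ N₀ : ℕ, ∃ N : ℕ, N₀ ≤ N ∧ ∃ a : ℤ,
          δ * (N : ℝ) ≤ (Set.ncard {j : ℤ | j ∈ Finset.Ico a (a + (N : ℤ)) ∧ j ∈ J'} : ℝ)) →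
        ∀ M : ι → ℤ, (∀ m : ℤ, m ≠ 0 → m • M ∉ Λ) →
          Set.Infinite ((fun j => ∑ i, (M i : ℂ) * q j i) '' J')) →
      ∀ δ : ℝ, 0 < δ → ∃ N₀ : ℕ, ∀ N : ℕ, N₀ ≤ N → ∀ a : ℤ,
        (Set.ncard {j : ℤ | j ∈ Finset.Ico a (a + (N : ℤ)) ∧ j ∈ J₀} : ℝ) < δ * (N : ℝ))
    (hCurve : ∀ (J₀ : Set ℤ),
      (∀ j ∈ J₀, LinearIndependent ℚ (q j) ∧ q j i₀ = c + 2 * ↑Real.pi * Complex.I * (j : ℂ)) →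
      (∀ ω : ι → ℂ, Set.Finite {j : ℤ | j ∈ J₀ ∧ Complex.exp ∘ q j = ω}) →
      (∃ (κ : Type) (ev : κ → ℂ) (j₀ : ℤ) (T : Finset (ι ⊕ ι)), j₀ ∈ J₀ ∧ T.card ≤ 1 ∧
        (∀ j ∈ J₀, ∀ H : MvPolynomial (κ ⊕ (ι ⊕ ι)) ℚ,
          MvPolynomial.aeval (Sum.elim ev (Sum.elim (q j₀) (Complex.exp ∘ q j₀))) H = 0 ↔
          MvPolynomial.aeval (Sum.elim ev (Sum.elim (q j) (Complex.exp ∘ q j))) H = 0) ∧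
        (∀ v : ι ⊕ ι, IsAlgebraic ↥(Algebra.adjoin ↥(IntermediateField.adjoin ℚ (Set.range ev))
          ((Sum.elim (q j₀) (Complex.exp ∘ q j₀)) '' (↑T : Set (ι ⊕ ι))))
          (Sum.elim (q j₀) (Complex.exp ∘ q j₀) v))) →
      ∀ δ : ℝ, 0 < δ → ∃ N₀ : ℕ, ∀ N : ℕ, N₀ ≤ N → ∀ a : ℤ,
        (Set.ncard {j : ℤ | j ∈ Finset.Ico a (a + (N : ℤ)) ∧ j ∈ J₀} : ℝ) < δ * (N : ℝ))
    (hLI : ∀ j ∈ J, LinearIndependent ℚ (q j) ∧ q j i₀ = c + 2 * ↑Real.pi * Complex.I * (j : ℂ))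
    (hfib : ∀ ω : ι → ℂ, Set.Finite {j : ℤ | j ∈ J ∧ Complex.exp ∘ q j = ω})
    (hdata : ∀ J' ⊆ J, (∃ δ : ℝ, 0 < δ ∧ ∀ N₀ : ℕ, ∃ N : ℕ, N₀ ≤ N ∧ ∃ a : ℤ,
        δ * (N : ℝ) ≤ (Set.ncard {j : ℤ | j ∈ Finset.Ico a (a + (N : ℤ)) ∧ j ∈ J'} : ℝ)) →
      ∀ Λ : Submodule ℤ (ι → ℤ),
        (∀ M ∈ Λ, ∀ j ∈ J', ∀ j' ∈ J', (∑ i, (M i : ℂ) * q j i) = ∑ i, (M i : ℂ) * q j' i) →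
        ∃ (κ : Type) (ev : κ → ℂ) (j₀ : ℤ) (T : Finset (ι ⊕ ι)), j₀ ∈ J' ∧
          (∀ j ∈ J', ∀ H : MvPolynomial (κ ⊕ (ι ⊕ ι)) ℚ,
            MvPolynomial.aeval (Sum.elim ev (Sum.elim (q j₀) (Complex.exp ∘ q j₀))) H = 0 ↔
            MvPolynomial.aeval (Sum.elim ev (Sum.elim (q j) (Complex.exp ∘ q j))) H = 0) ∧
          (∀ v : ι ⊕ ι, IsAlgebraic ↥(Algebra.adjoin ↥(IntermediateField.adjoin ℚ (Set.range ev))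
            ((Sum.elim (q j₀) (Complex.exp ∘ q j₀)) '' (↑T : Set (ι ⊕ ι))))
            (Sum.elim (q j₀) (Complex.exp ∘ q j₀) v)) ∧
          T.card + Module.finrank ℤ ↥Λ < Fintype.card ι)
    {J₁ : Set ℤ} (hJ₁ : J₁ ⊆ J) {δ : ℝ} (hδ : 0 < δ)
    (hwin : ∀ N₀ : ℕ, ∃ N : ℕ, N₀ ≤ N ∧ ∃ a : ℤ,
      δ * (N : ℝ) ≤ (Set.ncard {j : ℤ | j ∈ Finset.Ico a (a + (N : ℤ)) ∧ j ∈ J₁} : ℝ)) : False := by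
  classical
  -- ### the dead lattices `Λ(J')` of `q`, antitone in `J'`, of rank `≤ #ι`
  obtain ⟨dead, hmem⟩ := exists_deadLattice q
  have hanti : ∀ {J' J'' : Set ℤ}, J'' ⊆ J' → dead J' ≤ dead J'' := fun h M hM =>
    (hmem _ M).2 fun j hj j' hj' => (hmem _ M).1 hM j (h hj) j' (h hj')
  -- ### a positive-density sub-family with dead lattice of maximal rank
  set G : ℕ → Prop := fun t => ∃ J' ⊆ J, (∃ δ : ℝ, 0 < δ ∧ ∀ N₀ : ℕ, ∃ N : ℕ, N₀ ≤ N ∧ ∃ a : ℤ,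
      δ * (N : ℝ) ≤ (Set.ncard {j : ℤ | j ∈ Finset.Ico a (a + (N : ℤ)) ∧ j ∈ J'} : ℝ)) ∧
    Module.finrank ℤ (dead J') = t with hG
  have hG₁ : G (Module.finrank ℤ (dead J₁)) := ⟨J₁, hJ₁, ⟨δ, hδ, hwin⟩, rfl⟩
  obtain ⟨Js, hJsJ, hJspos, hJsrank⟩ : G (Nat.findGreatest G (Fintype.card ι)) :=
    Nat.findGreatest_spec (finrank_submodule_le_card (dead J₁)) hG₁
  have hmax : ∀ J' ⊆ J, (∃ δ : ℝ, 0 < δ ∧ ∀ N₀ : ℕ, ∃ N : ℕ, N₀ ≤ N ∧ ∃ a : ℤ,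
      δ * (N : ℝ) ≤ (Set.ncard {j : ℤ | j ∈ Finset.Ico a (a + (N : ℤ)) ∧ j ∈ J'} : ℝ)) →
      Module.finrank ℤ (dead J') ≤ Nat.findGreatest G (Fintype.card ι) :=
    fun J' hJ' hp => Nat.le_findGreatest (finrank_submodule_le_card (dead J')) ⟨J', hJ', hp, rfl⟩
  -- ### the generic data supplied by FCS♮ at `(Js, Λ(Js))`
  obtain ⟨κ, ev, j₀, T₀, hj₀, hiff, halg₀, hlt₀⟩ :=
    hdata Js hJsJ hJspos (dead Js) (fun M hM => (hmem Js M).1 hM)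
  -- ### shrinking the coordinate set to a maximal independent one
  obtain ⟨T, hT, halg⟩ := exists_finset_algebraicIndepOn_isAlgebraic
    (F := ↥(IntermediateField.adjoin ℚ (Set.range ev))) (Sum.elim (q j₀) (Complex.exp ∘ q j₀))
  have hTT₀ : T.card ≤ T₀.card := card_le_card_of_algebraicIndepOn_of_isAlgebraic _ hT halg₀
  have hlt : T.card + Module.finrank ℤ (dead Js) < Fintype.card ι := by omega
  -- ### the hypotheses along `Js`
  have hLIs : ∀ j ∈ Js, LinearIndependent ℚ (q j) ∧ q j i₀ = c + 2 * ↑Real.pi * Complex.I * (j : ℂ) :=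
    fun j hj => hLI j (hJsJ hj)
  have hfibs : ∀ ω : ι → ℂ, Set.Finite {j : ℤ | j ∈ Js ∧ Complex.exp ∘ q j = ω} :=
    fun ω => (hfib ω).subset fun j hj => ⟨hJsJ hj.1, hj.2⟩
  -- ### `Js` has density zero: CURVE if `#T ≤ 1`, FCS♮⁺ if `#T ≥ 2`
  have hzero : ∀ δ : ℝ, 0 < δ → ∃ N₀ : ℕ, ∀ N : ℕ, N₀ ≤ N → ∀ a : ℤ,
      (Set.ncard {j : ℤ | j ∈ Finset.Ico a (a + (N : ℤ)) ∧ j ∈ Js} : ℝ) < δ * (N : ℝ) := by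
    rcases Nat.lt_or_ge T.card 2 with hTle | hTge
    · exact hCurve Js hLIs hfibs ⟨κ, ev, j₀, T, hj₀, by omega, hiff, halg⟩
    · refine hPlus Js (dead Js) κ ev j₀ T hj₀ hTge hlt hLIs hfibs (fun M hM => (hmem Js M).1 hM)
        hiff hT halg ?_
      -- freeness modulo the maximal dead lattice
      intro J'' hJ'' hpos'' M hMfree hfin
      obtain ⟨δ'', hδ'', hwin''⟩ := hpos''
      obtain ⟨w, hw⟩ :=
        exists_fibre_of_posDensity hδ'' hwin'' (fun j => ∑ i, (M i : ℂ) * q j i) hfin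
      have hJ₃J : {k : ℤ | k ∈ J'' ∧ (∑ i, (M i : ℂ) * q k i) = w} ⊆ Js := fun j hj => hJ'' hj.1
      have hMD : M ∈ dead {k : ℤ | k ∈ J'' ∧ (∑ i, (M i : ℂ) * q k i) = w} :=
        (hmem _ M).2 fun j hj j' hj' => hj.2.trans hj'.2.symm
      have h1 := finrank_add_one_le_of_free (hanti hJ₃J) hMD hMfree
      have h2 := hmax _ (hJ₃J.trans hJsJ) hw
      omega
  -- ### density zero of `Js` contradicts its positive density
  obtain ⟨δs, hδs, hwins⟩ := hJspos
  obtain ⟨N₀, hN₀⟩ := hzero δs hδs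
  obtain ⟨N, hN, a, ha⟩ := hwins N₀
  exact (not_le.mpr (hN₀ N hN a)) ha

/-- **Stub R1♮ — FCS♮⁺ ∧ CURVE ⟹ FCS♮, THE GENERIC DIMENSION-DROP FORM (abstract; registered
signature).**  Granted generic free coset-line sparsity FCS♮⁺ (first hypothesis) and the curve
case (second hypothesis): if a fibre-finite coset family of ℚ-linearly independent points admits,
along EVERY sub-family `J'` of positive upper Banach density and for EVERY lattice `Λ` of
directions constant along `J'`, constants `ev` of the same type along `J'` and a coordinate set `T`
with `#T + rank Λ < #ι` over which (with `ℚ(ev)`) every coordinate of the base point is algebraic,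
then it has upper Banach density zero.  Proof: `false_of_posDensity_of_generic`. [folklore] -/
theorem stub_genericSparsity_of_free : (∀ (ι : Type) [Fintype ι] (i₀ : ι) (c : ℂ) (J : Set ℤ) (q : ℤ → ι → ℂ) (Λ : Submodule ℤ (ι → ℤ)) (κ : Type) (ev : κ → ℂ) (j₀ : ℤ) (T : Finset (ι ⊕ ι)), j₀ ∈ J → 2 ≤ T.card → T.card + Module.finrank ℤ ↥Λ < Fintype.card ι → (∀ j ∈ J, LinearIndependent ℚ (q j) ∧ q j i₀ = c + 2 * ↑Real.pi * Complex.I * (j : ℂ)) → (∀ ω : ι → ℂ, Set.Finite {j : ℤ | j ∈ J ∧ Complex.exp ∘ q j = ω}) → (∀ M ∈ Λ, ∀ j ∈ J, ∀ j' ∈ J, (∑ i, (M i : ℂ) * q j i) = ∑ i, (M i : ℂ) * q j' i) → (∀ j ∈ J, ∀ H : MvPolynomial (κ ⊕ (ι ⊕ ι)) ℚ, MvPolynomial.aeval (Sum.elim ev (Sum.elim (q j₀) (Complex.exp ∘ q j₀))) H = 0 ↔ MvPolynomial.aeval (Sum.elim ev (Sum.elim (q j) (Complex.exp ∘ q j)))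 H = 0) → AlgebraicIndependent ↥(IntermediateField.adjoin ℚ (Set.range ev)) (fun t : ↥T => Sum.elim (q j₀) (Complex.exp ∘ q j₀) (↑t : ι ⊕ ι)) → (∀ v : ι ⊕ ι, IsAlgebraic ↥(Algebra.adjoin ↥(IntermediateField.adjoin ℚ (Set.range ev)) ((Sum.elim (q j₀) (Complex.exp ∘ q j₀)) '' (↑T : Set (ι ⊕ ι)))) (Sum.elim (q j₀) (Complex.exp ∘ q j₀) v)) → (∀ J' ⊆ J, (∃ δ : ℝ, 0 < δ ∧ ∀ N₀ : ℕ, ∃ N : ℕ, N₀ ≤ N ∧ ∃ a : ℤ, δ * (N : ℝ) ≤ (Set.ncard {j : ℤ | j ∈ Finset.Ico a (a + (N : ℤ)) ∧ j ∈ J'} : ℝ)) → ∀ M : ι → ℤ, (∀ m : ℤ, m ≠ 0 → m • M ∉ Λ) → Set.Infinite ((fun j => ∑ i, (M i : ℂ) * q j i) '' J')) → ∀ δ : ℝ, 0 < δ → ∃ N₀ : ℕ, ∀ N : ℕ, N₀ ≤ N → ∀ a : ℤ, (Set.ncard {j : ℤ | j ∈ Finset.Ico a (a + (N : ℤ)) ∧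 j ∈ J} : ℝ) < δ * (N : ℝ)) → (∀ (ι : Type) [Fintype ι] (i₀ : ι) (c : ℂ) (J : Set ℤ) (q : ℤ → ι → ℂ), (∀ j ∈ J, LinearIndependent ℚ (q j) ∧ q j i₀ = c + 2 * ↑Real.pi * Complex.I * (j : ℂ)) → (∀ ω : ι → ℂ, Set.Finite {j : ℤ | j ∈ J ∧ Complex.exp ∘ q j = ω}) → (∃ (κ : Type) (ev : κ → ℂ) (j₀ : ℤ) (T : Finset (ι ⊕ ι)), j₀ ∈ J ∧ T.card ≤ 1 ∧ (∀ j ∈ J, ∀ H : MvPolynomial (κ ⊕ (ι ⊕ ι)) ℚ, MvPolynomial.aeval (Sum.elim ev (Sum.elim (q j₀) (Complex.exp ∘ q j₀))) H = 0 ↔ MvPolynomial.aeval (Sum.elim ev (Sum.elim (q j) (Complex.exp ∘ q j))) H = 0) ∧ (∀ v : ι ⊕ ι, IsAlgebraic ↥(Algebra.adjoin ↥(IntermediateField.adjoin ℚ (Set.range ev)) ((Sum.elim (q j₀) (Complex.exp ∘ q j₀)) '' (↑T : Set (ι ⊕ ι)))) (Sum.elim (q j₀) (Complex.exp ∘ q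 j₀) v))) → ∀ δ : ℝ, 0 < δ → ∃ N₀ : ℕ, ∀ N : ℕ, N₀ ≤ N → ∀ a : ℤ, (Set.ncard {j : ℤ | j ∈ Finset.Ico a (a + (N : ℤ)) ∧ j ∈ J} : ℝ) < δ * (N : ℝ)) → ∀ (ι : Type) [Fintype ι] (i₀ : ι) (c : ℂ) (J : Set ℤ) (q : ℤ → ι → ℂ), (∀ j ∈ J, LinearIndependent ℚ (q j) ∧ q j i₀ = c + 2 * ↑Real.pi * Complex.I * (j : ℂ)) → (∀ ω : ι → ℂ, Set.Finite {j : ℤ | j ∈ J ∧ Complex.exp ∘ q j = ω}) → (∀ J' ⊆ J, (∃ δ : ℝ, 0 < δ ∧ ∀ N₀ : ℕ, ∃ N : ℕ, N₀ ≤ N ∧ ∃ a : ℤ, δ * (N : ℝ) ≤ (Set.ncard {j : ℤ | j ∈ Finset.Ico a (a + (N : ℤ)) ∧ j ∈ J'} : ℝ)) → ∀ Λ : Submodule ℤ (ι → ℤ), (∀ M ∈ Λ, ∀ j ∈ J', ∀ j' ∈ J', (∑ i, (M i : ℂ) * q j i) = ∑ i, (M i : ℂ) * q j' i) → ∃ (κ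 : Type) (ev : κ → ℂ) (j₀ : ℤ) (T : Finset (ι ⊕ ι)), j₀ ∈ J' ∧ (∀ j ∈ J', ∀ H : MvPolynomial (κ ⊕ (ι ⊕ ι)) ℚ, MvPolynomial.aeval (Sum.elim ev (Sum.elim (q j₀) (Complex.exp ∘ q j₀))) H = 0 ↔ MvPolynomial.aeval (Sum.elim ev (Sum.elim (q j) (Complex.exp ∘ q j))) H = 0) ∧ (∀ v : ι ⊕ ι, IsAlgebraic ↥(Algebra.adjoin ↥(IntermediateField.adjoin ℚ (Set.range ev)) ((Sum.elim (q j₀) (Complex.exp ∘ q j₀)) '' (↑T : Set (ι ⊕ ι)))) (Sum.elim (q j₀) (Complex.exp ∘ q j₀) v)) ∧ T.card + Module.finrank ℤ ↥Λ < Fintype.card ι) → ∀ δ : ℝ, 0 < δ → ∃ N₀ : ℕ, ∀ N : ℕ, N₀ ≤ N → ∀ a : ℤ, (Set.ncard {j : ℤ | j ∈ Finset.Ico a (a + (N : ℤ)) ∧ j ∈ J} : ℝ) < δ * (N : ℝ) := by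
  intro hPlus hCurve ι _ i₀ c J q hLI hfib hdata δ hδ
  by_contra hcon
  push Not at hcon
  exact false_of_posDensity_of_generic i₀ c J q
    (fun J₀ Λ κ ev j₀ T => hPlus ι i₀ c J₀ q Λ κ ev j₀ T) (fun J₀ => hCurve ι i₀ c J₀ q)
    hLI hfib hdata subset_rfl hδ hcon

end Summit.Schanuel.Schanuel.Cruxes.MinimalCounterexampleInAcl.KernelArithmeticSelection

end
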